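/-
Copyright: the b2b-balaban T⁴-continuum CRUX team, row NE7b OWNER lineage `t4-ne7b-p1` (gen 145). Project licence.
-/
import Summits.QuantumFields.BalabanUV.T4Continuum.Spine.NE7b.SupTiltedMomentPhiConstituent

/-!
# THE SCALAR TILTED MOMENTS ARE `C¹` IN THE BACKGROUND (CONTINUITY OF THE TOP DERIVATIVE, SCOPING-d16 (4) ∕ (d14)(1), first file).
# (513) differentiated `ψ ↦ ∫e^{−U(ω+ψ)}p(ω+ψ)dN(0,Γ)` for a `C¹` scalar observable `p` of polynomial growth in `‖U′‖`:
# `HasFDerivAt … (∫e^{−U}•(p′ − p•U′)) ψ₀` at EVERY `ψ₀`, by the ball-uniform power domination.  The SAME domination makes the derivative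
# `ψ ↦ ∫e^{−U(ω+ψ)}•(p′(ω+ψ) − p(ω+ψ)•U′(ω+ψ))dN(0,Γ)` CONTINUOUS (dominated convergence, Mathlib's `continuousAt_of_dominated` on the unit ball,
# the integrand continuous in `ψ` for every `ω` since `U, U′, p, p′` are), hence the moment is `ContDiff ℝ 1` (`contDiff_one_iff_hasFDerivAt`).  THE
# ENDS instantiate this for the four constituents of (514)∕(515): `Z`, `G_v`, `H_{vw}`, `Φ_{hkl}` are `C¹` functions of the background for
# `U ∈ C⁴` with bounded `U″, U‴, U⁗` under the regulator (row NE7b, node U5c; (513) `hasFDerivAt_tilted_moment`, `norm_weighted_moment_deriv_le`,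
# `block_power_domination`, (401) `integrable_domination`, (514)∕(515) observables' calculus BY NAME; [folklore]).  WHY (the class at `d = 4`):
# the INPUT format carries `hU₅c : Continuous U₅`; the OUTPUT's fifth-order object `P(ψ)` ((639)) is `fderiv` of (521)'s centred display,
# a RATIONAL expression in `Z` and these moments (+ the `Ψ`-moment, next file) — so `P` is continuous as soon as the display is `ContDiff ℝ 1`,
# with NO written-out fifth display (the structural route; the display route of (d14)(1) is not needed).

Cell `pub-balaban`, sub-cell `t4`, spine estimate NE7b (`T4WeightBudget.RelWeightBound`; the cell's OWN estimate — NOT PRINTED in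
[Bałaban 1983–89], NOT PROVED).  Crux-route work under `Spine/NE7b/` by the row OWNER (`t4-ne7b-p1` gen 145, file (644)) under FREEZE
(0)'s crux-prover clause; NOTHING of Bałaban's is named as a Lean object, valued or asserted; no `T4Continuum/Support` leaf typed; no
`def`, no notation; zero `sorry`.  Imports (BY NAME): the OWNER's (515) `…SupTiltedMomentPhiConstituent` ((514), (513), (401) through it).

WHAT IS PROVED ([folklore]): §1 **`continuous_tilted_moment_fderiv`**, **`contDiff_one_tilted_moment`** (the engine); §2 THE ENDS
**`contDiff_one_Z`**, **`contDiff_one_G`**, **`contDiff_one_H`**, **`contDiff_one_Phi`**; §3 toy.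

HONEST (what this is NOT).  Calculus only; the `Ψ`-moment (needs `U ∈ C⁵`), the `C¹`-ness of the fourth-derivative display and the
continuity of `P` are the next files; nothing is evaluated; `U ∈ C⁴` with bounded derivatives and the regulator are hypotheses; scalar
skeleton ((A3), NC-NE7b-α UNRULED); nothing of Bałaban's asserted.  BY-NAME EFFECT ON THE WALL: NONE.  NE7b NOT PRINTED ∕ NOT PROVED; spine
PROVED 0∕9; rung (B)+1 — the programme's measures remain FINITE-torus statements; NOT the mass gap, NOT Clay.  HONEST DEPENDENCY: continuum YM
on T⁴ ⇐ BetaPertH ∧ nine spine estimates (0∕9 proved); BetaPertH ⇐ (D1) ∧ (D4) ∧ CAP+tail; G-an2-4 gates asym, D1 and NE2∕3∕4.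
-/

set_option autoImplicit false
set_option maxSynthPendingDepth 3

noncomputable section

namespace Summit.QuantumFields.BalabanUV.T4Continuum.NE7b.SupTiltedMomentContDiff

open MeasureTheory ProbabilityTheory Finset Real Metric Filter
open scoped BigOperators Topology
open SupEffectiveActionDerivative (integrable_domination)
open SupTiltedScalarMomentCalculus (hasFDerivAt_tilted_moment norm_weighted_moment_deriv_le block_power_domination)
open SupTiltedMomentConstituents (hasFDerivAt_entry_one norm_eval_comp_one_le abs_entry_one_le hasFDerivAt_obs_two abs_obs_two_le
  norm_obs_two_deriv_le continuous_obs_two_deriv)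
open SupTiltedMomentPhiConstituent (hasFDerivAt_obs_three abs_obs_three_le norm_obs_three_deriv_le continuous_obs_three_deriv)

variable {ι : Type} [Fintype ι] [DecidableEq ι]

/-! ## §1. The engine: the derivative of a tilted moment is continuous; the moment is `C¹` -/

section Engine

variable {Γ : Matrix ι ι ℝ} {γop : ℝ} {U : EuclideanSpace ℝ ι → ℝ} {U' : EuclideanSpace ℝ ι → EuclideanSpace ℝ ι →L[ℝ] ℝ} {p : EuclideanSpace ℝ ι → ℝ}
  {p' : EuclideanSpace ℝ ι → EuclideanSpace ℝ ι →L[ℝ] ℝ} {κ₀ κ₁ a τ δ θ Cp : ℝ} {n : ℕ}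

/-- **The derivative of a scalar tilted moment is continuous in the background**: for `U ∈ C¹` with the block letters, `Γ ⪰ 0` under the
regulator and a `C¹` scalar `p` with `|p|, ‖p′‖ ≤ C(1+‖U′‖)ⁿ`, `ψ ↦ ∫e^{−U(ω+ψ)}•(p′(ω+ψ) − p(ω+ψ)•U′(ω+ψ))dN(0,Γ)` is continuous
(dominated convergence on unit balls with (513)'s power domination). [folklore] -/
theorem continuous_tilted_moment_fderiv (hΓ : Γ.PosSemidef) (hΓop : (γop • (1 : Matrix ι ι ℝ) - Γ).PosSemidef) (Y : Finset ι)
    (hUd : ∀ φ : EuclideanSpace ℝ ι, HasFDerivAt U (U' φ) φ) (hU'c : Continuous U') (hp : ∀ φ : EuclideanSpace ℝ ι, HasFDerivAt p (p' φ) φ)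
    (hp'c : Continuous p') (hκ₀ : 0 ≤ κ₀) (hκ₁ : 0 ≤ κ₁) (ha : 0 ≤ a) (hτ : 0 < τ) (hδ : 0 < δ) (hθ1 : θ < 1)
    (hκθ : (2 * κ₀ * (1 + τ) + 4 * δ) * γop ≤ θ) (hstab : ∀ φ : EuclideanSpace ℝ ι, -(κ₀ * ∑ x ∈ Y, φ x ^ 2) ≤ U φ)
    (hU'b : ∀ φ : EuclideanSpace ℝ ι, ‖U' φ‖ ≤ κ₁ * (a + ∑ x ∈ Y, φ x ^ 2)) (hpb : ∀ φ : EuclideanSpace ℝ ι, |p φ| ≤ Cp * (1 + ‖U' φ‖) ^ n)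
    (hp'b : ∀ φ : EuclideanSpace ℝ ι, ‖p' φ‖ ≤ Cp * (1 + ‖U' φ‖) ^ n) :
    Continuous (fun ψ : EuclideanSpace ℝ ι => ∫ ω : EuclideanSpace ℝ ι, exp (-U (ω + ψ)) • (p' (ω + ψ) - p (ω + ψ) • U' (ω + ψ))
      ∂(multivariateGaussian 0 Γ)) := by
  have hUc : Continuous U := continuous_iff_continuousAt.2 fun φ => (hUd φ).continuousAt
  have hpc : Continuous p := continuous_iff_continuousAt.2 fun φ => (hp φ).continuousAt
  have hCp : 0 ≤ Cp := by
    have h := hp'b 0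
    have h1 : 0 < (1 + ‖U' 0‖) ^ n := by positivity
    nlinarith [norm_nonneg (p' 0)]
  have hmeas : ∀ ψ : EuclideanSpace ℝ ι, AEStronglyMeasurable (fun ω : EuclideanSpace ℝ ι => exp (-U (ω + ψ)) • (p' (ω + ψ) - p (ω + ψ) •
      U' (ω + ψ))) (multivariateGaussian 0 Γ) := fun ψ =>
    ((continuous_exp.comp (hUc.comp (continuous_id.add continuous_const)).neg).smul ((hp'c.comp (continuous_id.add continuous_const)).sub
      ((hpc.comp (continuous_id.add continuous_const)).smul (hU'c.comp (continuous_id.add continuous_const))))).aestronglyMeasurable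
  refine continuous_iff_continuousAt.2 fun ψ₀ => ?_
  refine continuousAt_of_dominated (Eventually.of_forall hmeas) ?_
    ((integrable_domination hΓ hΓop Y hκ₀ hτ hδ hθ1 hκθ
      ((2 ^ (n + 1) * ((1 + κ₁ * (a + 2 * (2 * ∑ x ∈ Y, ψ₀ x ^ 2 + 2))) ^ (n + 1) + (κ₁ / δ) ^ (n + 1) * ((n + 1)).factorial) * exp (κ₀ * (1 + τ⁻¹) *
          (2 * ∑ x ∈ Y, ψ₀ x ^ 2 + 2))))).const_mul Cp) (ae_of_all _ fun ω => ?_)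
  · filter_upwards [closedBall_mem_nhds ψ₀ one_pos] with ψ hψ
    rw [mem_closedBall, dist_eq_norm] at hψ
    exact ae_of_all _ fun ω => (norm_weighted_moment_deriv_le hpb hp'b ω ψ).trans
      (mul_le_mul_of_nonneg_left (block_power_domination Y (n + 1) hκ₀ hκ₁ ha hτ hδ hstab hU'b ψ₀ ψ hψ ω) hCp)
  · exact ((continuous_exp.comp (hUc.comp (continuous_const.add continuous_id)).neg).smul ((hp'c.comp (continuous_const.add continuous_id)).sub
      ((hpc.comp (continuous_const.add continuous_id)).smul (hU'c.comp (continuous_const.add continuous_id))))).continuousAt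

/-- **A scalar tilted moment of a `C¹` observable of polynomial growth is `C¹` in the background** (`ContDiff ℝ 1`): (513)'s derivative
at every `ψ₀` + its continuity. [folklore] -/
theorem contDiff_one_tilted_moment (hΓ : Γ.PosSemidef) (hΓop : (γop • (1 : Matrix ι ι ℝ) - Γ).PosSemidef) (Y : Finset ι)
    (hUd : ∀ φ : EuclideanSpace ℝ ι, HasFDerivAt U (U' φ) φ) (hU'c : Continuous U') (hp : ∀ φ : EuclideanSpace ℝ ι, HasFDerivAt p (p' φ) φ)
    (hp'c : Continuous p') (hκ₀ : 0 ≤ κ₀) (hκ₁ : 0 ≤ κ₁) (ha : 0 ≤ a) (hτ : 0 < τ) (hδ : 0 < δ) (hθ1 : θ < 1)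
    (hκθ : (2 * κ₀ * (1 + τ) + 4 * δ) * γop ≤ θ) (hstab : ∀ φ : EuclideanSpace ℝ ι, -(κ₀ * ∑ x ∈ Y, φ x ^ 2) ≤ U φ)
    (hU'b : ∀ φ : EuclideanSpace ℝ ι, ‖U' φ‖ ≤ κ₁ * (a + ∑ x ∈ Y, φ x ^ 2)) (hpb : ∀ φ : EuclideanSpace ℝ ι, |p φ| ≤ Cp * (1 + ‖U' φ‖) ^ n)
    (hp'b : ∀ φ : EuclideanSpace ℝ ι, ‖p' φ‖ ≤ Cp * (1 + ‖U' φ‖) ^ n) :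
    ContDiff ℝ 1 (fun ψ : EuclideanSpace ℝ ι => ∫ ω : EuclideanSpace ℝ ι, exp (-U (ω + ψ)) * p (ω + ψ) ∂(multivariateGaussian 0 Γ)) :=
  contDiff_one_iff_hasFDerivAt.2 ⟨_, continuous_tilted_moment_fderiv hΓ hΓop Y hUd hU'c hp hp'c hκ₀ hκ₁ ha hτ hδ hθ1 hκθ hstab hU'b hpb hp'b,
    fun ψ₀ => hasFDerivAt_tilted_moment hΓ hΓop Y hUd hU'c hp hp'c hκ₀ hκ₁ ha hτ hδ hθ1 hκθ hstab hU'b hpb hp'b ψ₀⟩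

end Engine

/-! ## §2. THE ENDS: the four constituents `Z`, `G_v`, `H_{vw}`, `Φ_{hkl}` are `C¹` in the background -/

section TheEnds

variable {Γ : Matrix ι ι ℝ} {γop : ℝ} {U : EuclideanSpace ℝ ι → ℝ} {U' : EuclideanSpace ℝ ι → EuclideanSpace ℝ ι →L[ℝ] ℝ}
  {U'' : EuclideanSpace ℝ ι → EuclideanSpace ℝ ι →L[ℝ] EuclideanSpace ℝ ι →L[ℝ] ℝ}
  {U₃ : EuclideanSpace ℝ ι → EuclideanSpace ℝ ι →L[ℝ] EuclideanSpace ℝ ι →L[ℝ] EuclideanSpace ℝ ι →L[ℝ] ℝ}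
  {U₄ : EuclideanSpace ℝ ι → EuclideanSpace ℝ ι →L[ℝ] EuclideanSpace ℝ ι →L[ℝ] EuclideanSpace ℝ ι →L[ℝ] EuclideanSpace ℝ ι →L[ℝ] ℝ}
  {κ₀ κ₁ κ₂ κ₃ κ₄ a τ δ θ : ℝ} {h k l : EuclideanSpace ℝ ι}

/-- **`Z` is `C¹` in the background** (the observable `1`). [folklore] -/
theorem contDiff_one_Z (hΓ : Γ.PosSemidef) (hΓop : (γop • (1 : Matrix ι ι ℝ) - Γ).PosSemidef) (Y : Finset ι)
    (hUd : ∀ φ : EuclideanSpace ℝ ι, HasFDerivAt U (U' φ) φ) (hU'c : Continuous U') (hκ₀ : 0 ≤ κ₀) (hκ₁ : 0 ≤ κ₁) (ha : 0 ≤ a) (hτ : 0 < τ)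
    (hδ : 0 < δ) (hθ1 : θ < 1) (hκθ : (2 * κ₀ * (1 + τ) + 4 * δ) * γop ≤ θ)
    (hstab : ∀ φ : EuclideanSpace ℝ ι, -(κ₀ * ∑ x ∈ Y, φ x ^ 2) ≤ U φ) (hU'b : ∀ φ : EuclideanSpace ℝ ι, ‖U' φ‖ ≤ κ₁ * (a + ∑ x ∈ Y, φ x ^ 2)) :
    ContDiff ℝ 1 (fun ψ : EuclideanSpace ℝ ι => ∫ ω : EuclideanSpace ℝ ι, exp (-U (ω + ψ)) ∂(multivariateGaussian 0 Γ)) := by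
  simpa only [mul_one] using contDiff_one_tilted_moment (p := fun _ => (1 : ℝ)) (p' := fun _ => (0 : EuclideanSpace ℝ ι →L[ℝ] ℝ)) (Cp := 1)
    (n := 0) hΓ hΓop Y hUd hU'c (fun φ => hasFDerivAt_const (1 : ℝ) φ) continuous_const hκ₀ hκ₁ ha hτ hδ hθ1 hκθ hstab hU'b (fun φ => by simp)
    (fun φ => by simp)

/-- **`G_v` is `C¹` in the background** for `‖v‖ ≤ 1` (the observable `U′·v`, growth `(1+κ₂)(1+‖U′‖)`). [folklore] -/
theorem contDiff_one_G (hΓ : Γ.PosSemidef) (hΓop : (γop • (1 : Matrix ι ι ℝ) - Γ).PosSemidef) (Y : Finset ι)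
    (hUd : ∀ φ : EuclideanSpace ℝ ι, HasFDerivAt U (U' φ) φ) (hU'd : ∀ φ : EuclideanSpace ℝ ι, HasFDerivAt U' (U'' φ) φ) (hU''c : Continuous U'')
    (hκ₀ : 0 ≤ κ₀) (hκ₁ : 0 ≤ κ₁) (ha : 0 ≤ a) (hτ : 0 < τ) (hδ : 0 < δ) (hθ1 : θ < 1) (hκθ : (2 * κ₀ * (1 + τ) + 4 * δ) * γop ≤ θ)
    (hstab : ∀ φ : EuclideanSpace ℝ ι, -(κ₀ * ∑ x ∈ Y, φ x ^ 2) ≤ U φ) (hU'b : ∀ φ : EuclideanSpace ℝ ι, ‖U' φ‖ ≤ κ₁ * (a + ∑ x ∈ Y, φ x ^ 2))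
    (hU''b : ∀ φ : EuclideanSpace ℝ ι, ‖U'' φ‖ ≤ κ₂) (v : EuclideanSpace ℝ ι) (hv : ‖v‖ ≤ 1) :
    ContDiff ℝ 1 (fun ψ : EuclideanSpace ℝ ι => ∫ ω : EuclideanSpace ℝ ι, exp (-U (ω + ψ)) * U' (ω + ψ) v ∂(multivariateGaussian 0 Γ)) := by
  have hU'c : Continuous U' := continuous_iff_continuousAt.2 fun φ => (hU'd φ).continuousAt
  have hκ₂ : 0 ≤ κ₂ := (norm_nonneg (U'' 0)).trans (hU''b 0)
  refine contDiff_one_tilted_moment (p := fun φ => U' φ v) (p' := fun φ => ((ContinuousLinearMap.apply ℝ ℝ v).comp (U'' φ))) (Cp := 1 + κ₂)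
      (n := 1) hΓ hΓop Y hUd hU'c (fun φ => hasFDerivAt_entry_one hU'd v φ) (continuous_const.clm_comp hU''c) hκ₀ hκ₁ ha hτ hδ hθ1 hκθ hstab hU'b
    (fun φ => ?_) (fun φ => ?_)
  · calc |U' φ v| ≤ ‖U' φ‖ * ‖v‖ := abs_entry_one_le _ _
      _ ≤ ‖U' φ‖ * 1 := mul_le_mul_of_nonneg_left hv (norm_nonneg _)
      _ ≤ (1 + κ₂) * (1 + ‖U' φ‖) ^ 1 := by rw [pow_one]; nlinarith [norm_nonneg (U' φ)]
  · calc ‖((ContinuousLinearMap.apply ℝ ℝ v).comp (U'' φ))‖ ≤ ‖v‖ * ‖U'' φ‖ := norm_eval_comp_one_le _ _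
      _ ≤ 1 * κ₂ := mul_le_mul hv (hU''b φ) (norm_nonneg _) zero_le_one
      _ ≤ (1 + κ₂) * (1 + ‖U' φ‖) ^ 1 := by rw [pow_one]; nlinarith [norm_nonneg (U' φ)]

/-- **`H_{vw}` is `C¹` in the background** for `‖v‖, ‖w‖ ≤ 1` (the observable `U″vw − U′vU′w`, growth `(1+2κ₂+κ₃)(1+‖U′‖)²`). [folklore] -/
theorem contDiff_one_H (hΓ : Γ.PosSemidef) (hΓop : (γop • (1 : Matrix ι ι ℝ) - Γ).PosSemidef) (Y : Finset ι)
    (hUd : ∀ φ : EuclideanSpace ℝ ι, HasFDerivAt U (U' φ) φ) (hU'd : ∀ φ : EuclideanSpace ℝ ι, HasFDerivAt U' (U'' φ) φ)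
    (hU''d : ∀ φ : EuclideanSpace ℝ ι, HasFDerivAt U'' (U₃ φ) φ) (hU₃c : Continuous U₃) (hκ₀ : 0 ≤ κ₀) (hκ₁ : 0 ≤ κ₁) (ha : 0 ≤ a) (hτ : 0 < τ)
    (hδ : 0 < δ) (hθ1 : θ < 1) (hκθ : (2 * κ₀ * (1 + τ) + 4 * δ) * γop ≤ θ)
    (hstab : ∀ φ : EuclideanSpace ℝ ι, -(κ₀ * ∑ x ∈ Y, φ x ^ 2) ≤ U φ) (hU'b : ∀ φ : EuclideanSpace ℝ ι, ‖U' φ‖ ≤ κ₁ * (a + ∑ x ∈ Y, φ x ^ 2))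
    (hU''b : ∀ φ : EuclideanSpace ℝ ι, ‖U'' φ‖ ≤ κ₂) (hU₃b : ∀ φ : EuclideanSpace ℝ ι, ‖U₃ φ‖ ≤ κ₃) (v w : EuclideanSpace ℝ ι) (hv : ‖v‖ ≤ 1)
    (hw : ‖w‖ ≤ 1) :
    ContDiff ℝ 1 (fun ψ : EuclideanSpace ℝ ι => ∫ ω : EuclideanSpace ℝ ι, exp (-U (ω + ψ)) * (U'' (ω + ψ) v w - U' (ω + ψ) v * U' (ω + ψ) w)
      ∂(multivariateGaussian 0 Γ)) := by
  have hU'c : Continuous U' := continuous_iff_continuousAt.2 fun φ => (hU'd φ).continuousAt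
  have hU''c : Continuous U'' := continuous_iff_continuousAt.2 fun φ => (hU''d φ).continuousAt
  exact contDiff_one_tilted_moment (p := fun φ => (U'' φ v w - U' φ v * U' φ w)) (Cp := 1 + 2 * κ₂ + κ₃) (n := 2) hΓ hΓop Y hUd hU'c
    (fun φ => hasFDerivAt_obs_two hU'd hU''d v w φ) (continuous_obs_two_deriv hU'd hU''c hU₃c v w) hκ₀ hκ₁ ha hτ hδ hθ1 hκθ hstab hU'b
    (fun φ => abs_obs_two_le hU''b hU₃b v w hv hw φ) (fun φ => norm_obs_two_deriv_le hU''b hU₃b v w hv hw φ)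

/-- **`Φ_{hkl}` is `C¹` in the background** for `‖h‖, ‖k‖, ‖l‖ ≤ 1` (the observable `p₃`, growth `(1+3κ₂+3κ₂²+4κ₃+κ₄)(1+‖U′‖)³`; needs
`U ∈ C⁴`). [folklore] -/
theorem contDiff_one_Phi (hΓ : Γ.PosSemidef) (hΓop : (γop • (1 : Matrix ι ι ℝ) - Γ).PosSemidef) (Y : Finset ι)
    (hUd : ∀ φ : EuclideanSpace ℝ ι, HasFDerivAt U (U' φ) φ) (hU'd : ∀ φ : EuclideanSpace ℝ ι, HasFDerivAt U' (U'' φ) φ)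
    (hU''d : ∀ φ : EuclideanSpace ℝ ι, HasFDerivAt U'' (U₃ φ) φ) (hU₃d : ∀ φ : EuclideanSpace ℝ ι, HasFDerivAt U₃ (U₄ φ) φ) (hU₄c : Continuous U₄)
    (hκ₀ : 0 ≤ κ₀) (hκ₁ : 0 ≤ κ₁) (ha : 0 ≤ a) (hτ : 0 < τ) (hδ : 0 < δ) (hθ1 : θ < 1) (hκθ : (2 * κ₀ * (1 + τ) + 4 * δ) * γop ≤ θ)
    (hstab : ∀ φ : EuclideanSpace ℝ ι, -(κ₀ * ∑ x ∈ Y, φ x ^ 2) ≤ U φ) (hU'b : ∀ φ : EuclideanSpace ℝ ι, ‖U' φ‖ ≤ κ₁ * (a + ∑ x ∈ Y, φ x ^ 2))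
    (hU''b : ∀ φ : EuclideanSpace ℝ ι, ‖U'' φ‖ ≤ κ₂) (hU₃b : ∀ φ : EuclideanSpace ℝ ι, ‖U₃ φ‖ ≤ κ₃) (hU₄b : ∀ φ : EuclideanSpace ℝ ι, ‖U₄ φ‖ ≤ κ₄)
    (hh : ‖h‖ ≤ 1) (hk : ‖k‖ ≤ 1) (hl : ‖l‖ ≤ 1) :
    ContDiff ℝ 1 (fun ψ : EuclideanSpace ℝ ι => ∫ ω : EuclideanSpace ℝ ι, exp (-U (ω + ψ)) * (U₃ (ω + ψ) h k l - U' (ω + ψ) k * U'' (ω + ψ) h l - U''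
        (ω + ψ) h k * U' (ω + ψ) l - U' (ω + ψ) h * U'' (ω + ψ) k l + U' (ω + ψ) h * U' (ω + ψ) k * U' (ω + ψ) l) ∂(multivariateGaussian 0 Γ)) := by
  have hU'c : Continuous U' := continuous_iff_continuousAt.2 fun φ => (hU'd φ).continuousAt
  have hU₃c : Continuous U₃ := continuous_iff_continuousAt.2 fun φ => (hU₃d φ).continuousAt
  exact contDiff_one_tilted_moment (p := fun φ => (U₃ φ h k l - U' φ k * U'' φ h l - U'' φ h k * U' φ l - U' φ h * U'' φ k l + U' φ h * U' φ k *
      U' φ l)) (Cp := (1 + 3 * κ₂ + 3 * κ₂ ^ 2 + 4 * κ₃ + κ₄)) (n := 3) hΓ hΓop Y hUd hU'c (fun φ => hasFDerivAt_obs_three hU'd hU''d hU₃d h k l φ)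
    (continuous_obs_three_deriv hU'd hU''d hU₃c hU₄c h k l) hκ₀ hκ₁ ha hτ hδ hθ1 hκθ hstab hU'b (fun φ => abs_obs_three_le hU''b hU₃b hU₄b hh hk hl φ)
    (fun φ => norm_obs_three_deriv_le hU''b hU₃b hU₄b hh hk hl φ)

end TheEnds

/-! ## §3. Toy -/

/-- Toy (the engine's last step in one variable): a derivative at every point plus its continuity is `C¹`. -/
example (f f' : ℝ → ℝ) (hf : ∀ x, HasDerivAt f (f' x) x) (hc : Continuous f') : ContDiff ℝ 1 f :=
  contDiff_one_iff_hasFDerivAt.2 ⟨fun x => (ContinuousLinearMap.smulRight (1 : ℝ →L[ℝ] ℝ) (f' x)), by fun_prop, fun x => (hf x).hasFDerivAt⟩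

end Summit.QuantumFields.BalabanUV.T4Continuum.NE7b.SupTiltedMomentContDiff

end
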